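import Summits.Ventures.CertifiedManyBodySolver.Observables.CanonicalResponseMonotoneInField
import Summits.Ventures.CertifiedManyBodySolver.Observables.CanonicalFloorW64W32TwoW5K3o7R529Continuum
import Summits.Ventures.CertifiedManyBodySolver.Observables.CanonicalCeilingW32TwoW5NearRowsT0
import Summits.Ventures.CertifiedManyBodySolver.Observables.CanonicalCeilingW64W32TwoW5NearRowsT0
import HarnessLib

/-!
# FQ1(c) SECANT / SECOND-DIFFERENCE INSTANCES ON NODES between certified fields (hubbard-floor eng-1 g4; zero compute)

The director's FQ1 row asks for «the secant / second-difference inequalities between certified fields as typed theorems on nodes». eng-1 g2's p676488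
`Observables/CanonicalResponseMonotoneInField.lean` proved them CERTIFICATE-FREE for every pair / triple of fields (Griffiths secant, monotonicity, second
difference, transport). This file records the INSTANCES ON NODES at certified fields of the A0′ (t′ = 0, floor edition #529) column, i.e. the secant
inequalities COMBINED with the certified floor / lid words, which is the only place where nodes enter:

* `energyDrop_n7o8_tp0_r529_g4o25_g1o4_bounds` — for translation-invariant density-⅞ MINIMISERS ω₁ of E_{h₁}, h₁ = √2·4/25 (h_tree ≈ 0.22627, the FQ1(b) cell) and ω₂ of
  E_{h₂}, h₂ = √2·1/4 (≈ 0.35355): **0.0037571 ≤ E_{h₁}(ω₁) − E_{h₂}(ω₂) ≤ 0.2363763** per site, from `2(h₂−h₁)·m(ω₁) ≤ ΔE ≤ 2(h₂−h₁)·m(ω₂)` (p676488) with the floor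
  of record `m(ω₁) ≥ 0.0147595` (cq p539006 `canonicalFloor_n7o8_tp0_W64W32twoW5k3o7r529_decimal_g4o25`; nodes #529 + 64 × 4 κ 3/7 μ* box j276038 (R5′) ⊕ 32 × 4 κ 3/7 μ₀ 2 twin
  j269676 (R6)) and the v17 lid of record `m(ω₂) ≤ 0.9285738` (cq p708763 `canonicalCeiling_n7o8_tp0_W32twoW5k4o7_b0_decimal_g1o4_r5o7`; κ 4/7 twins j270192 ⊕ j271580 + pin-1 menu row 5/7
  j287398; the v21 minimal lid 0.9274741 of eng-1 p710806 would tighten the upper end to 0.2360964 — same shape); exact ends 2√2·(9/100)·0.0147595 = 0.0037571553… (7 dp DOWN via √2 > 1.4142135623) and 2√2·(9/100)·0.9285738 = 0.2363762…  (7 dp UP via √2 < 1.4142135624).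
* `secondDifference_n7o8_tp0_g4o25_g1o4_g2o7` — the second-difference (concavity) inequality `(h₃−h₂)(E₁−E₂) ≤ (h₂−h₁)(E₂−E₃)` at the three certified fields
  h = √2·4/25, √2·1/4, √2·2/7 (certificate-free specialisation of `secant_secondDifference_nonpos`; needs only the three minimiser binders).

* `energyDrop_n7o8_tp0_r529_g4o25_g1o4_bounds_W64W32lid` (§2, hubbard-floor eng-1 g5 append; the v21-LID EDITION pre-stated by the lead's FL-RULING 86 (c)) — same two states,
  **0.0037571 ≤ E_{h₁}(ω₁) − E_{h₂}(ω₂) ≤ 0.2360964**: the upper end now uses the v21 minimal lid `m(ω₂) ≤ 0.9274741` (eng-1 p710806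
  `canonicalCeiling_n7o8_tp0_W64W32twoW5k3o7_b1_decimal_g1o4_r5o7`, W64 ⊕ W32 κ 3/7 cap line b1 vs pin-1 row 5/7), whose W5 nodes ARE the floor's R5′ ⊕ R6 boxes ⇒ the node
  premise set SHRINKS to {#529; j276038 ⊕ j269676; row 5/7 j287398} (4 names; the κ 4/7 twins j270192 ⊕ j271580 drop out); exact upper end 2√2·(9/100)·0.9274741 = 0.2360963611…/…612… ⇒ 7 dp UP 0.2360964 at both √2 ends (minimal: 0.2360963 fails).

READING (pre-stated, unchanged): the energy-drop bracket is [0.0038, 0.2364] wide because the cells are kinematic (m⁺ − m⁻ ≥ 0.83); it is an arithmetic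
corollary of numbers of record and carries NO information about the shape of m(h) below the kinematic scale — the FQ1(c) «INFORMATIVE = NO» sentence stands.
HONEST FRAMING: statements about translation-invariant density-⅞ minimisers of the d-wave-SOURCED energy at (U, n, t′) = (8, ⅞, 0), CONDITIONAL by name on the
listed nodes; never an onset, an order parameter, a gap or `T_c`; superconductivity in the Hubbard model is NOT proved or disproved by any of this.
No definition; no named fact; no new node; no `sorry`. References: R. B. Griffiths, Phys. Rev. 152 (1966) 240 §II; T. Koma, H. Tasaki, J. Stat. Phys. 76 (1994) 745 §1.
-/

noncomputable section

namespace Summit.Ventures.CertifiedManyBodySolver.Observables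

open Matrix Finset Literature.Probability.LatticeModels
open Literature.MathematicalPhysics.QuantumLattice Literature.MathematicalPhysics.QuantumLattice.ThermodynamicLimit
open Literature.MathematicalPhysics.QuantumLattice.TwoCluster InfVolFermionState
open Summit.Ventures.CertifiedManyBodySolver Summit.Ventures.CertifiedManyBodySolver.Certificates
open scoped ComplexOrder

variable {ω₁ ω₂ ω₃ : InfVolFermionState 2}

/-- **CERTIFIED ENERGY-DROP BRACKET between the fields `h₁ = √2·4/25` and `h₂ = √2·1/4` (A0′, #529 floor / v17 near-row lid).** For translation-invariant
density-⅞ minimisers `ω₁` of `E_{h₁}` and `ω₂` of `E_{h₂}`: `0.0037571 ≤ E_{h₁}(ω₁) − E_{h₂}(ω₂) ≤ 0.2363763` (energies per site). Lower end = Griffiths secant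
`2(h₂−h₁)·m(ω₁) ≤ ΔE` (p676488) + floor `0.0147595 ≤ m(ω₁)` (cq p539006); upper end = `ΔE ≤ 2(h₂−h₁)·m(ω₂)` + lid `m(ω₂) ≤ 0.9274741` (eng-1 p710806); `√2 ∈ (1.4142135623, 1.4142135624)`.
CONDITIONAL by name on #529, the κ 3/7 boxes (floor), the κ 4/7 twins + the pin-1 row 5/7 (lid); an arithmetic corollary of numbers of record (kinematic width), no shape information. [cite: Griffiths1966, §II] -/
theorem energyDrop_n7o8_tp0_r529_g4o25_g1o4_bounds
    (hω₁ : ω₁.IsTranslationInvariant) (hρ₁ : ω₁.density = 7 / 8)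
    (hmin₁ : ∀ ω' : InfVolFermionState 2, ω'.IsTranslationInvariant → ω'.density = 7 / 8 →
      ω₁.meanEnergy (hubbardTTPrimeSourcedInteraction 1 0 8 0 dWaveFormFactor (Real.sqrt 2 * (4 / 25 : ℝ))) 1 ≤
        ω'.meanEnergy (hubbardTTPrimeSourcedInteraction 1 0 8 0 dWaveFormFactor (Real.sqrt 2 * (4 / 25 : ℝ))) 1)
    (hω₂ : ω₂.IsTranslationInvariant) (hρ₂ : ω₂.density = 7 / 8)
    (hmin₂ : ∀ ω' : InfVolFermionState 2, ω'.IsTranslationInvariant → ω'.density = 7 / 8 →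
      ω₂.meanEnergy (hubbardTTPrimeSourcedInteraction 1 0 8 0 dWaveFormFactor (Real.sqrt 2 * (1 / 4 : ℝ))) 1 ≤
        ω'.meanEnergy (hubbardTTPrimeSourcedInteraction 1 0 8 0 dWaveFormFactor (Real.sqrt 2 * (1 / 4 : ℝ))) 1)
    (hfl : cert_r529_HYB_GU8n7o8eom8_w3_b4_R2_ob5p2_kry1_kry2c3rel_menu_core_focert_it2000)
    (hW₁ : cert_sgf_openbox64x4_U8_mu980464777135o549755813888_k3o7_j276038_twoField) (hW₂ : cert_sgf_openbox32x4_U8_mu2_k3o7_j269676_twoField)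
    (hV₁ : cert_sgf_openbox32x4_U8_mu2_k4o7_j270192_twoField) (hV₂ : cert_sgf_openbox32x4_U8_mu9o4_k4o7_j271580_twoField)
    (hN : cert_pin1menuA0p_L3h0_U8_tp0_g5o7_E_j287398) :
    (0.0037571 : ℝ) ≤ ω₁.meanEnergy (hubbardTTPrimeSourcedInteraction 1 0 8 0 dWaveFormFactor (Real.sqrt 2 * (4 / 25 : ℝ))) 1 -
        ω₂.meanEnergy (hubbardTTPrimeSourcedInteraction 1 0 8 0 dWaveFormFactor (Real.sqrt 2 * (1 / 4 : ℝ))) 1 ∧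
      ω₁.meanEnergy (hubbardTTPrimeSourcedInteraction 1 0 8 0 dWaveFormFactor (Real.sqrt 2 * (4 / 25 : ℝ))) 1 -
        ω₂.meanEnergy (hubbardTTPrimeSourcedInteraction 1 0 8 0 dWaveFormFactor (Real.sqrt 2 * (1 / 4 : ℝ))) 1 ≤ (0.2363763 : ℝ) := by
  have hs1 : (14142135623 / 10 ^ 10 : ℝ) < Real.sqrt 2 := by rw [Real.lt_sqrt (by norm_num)]; norm_num
  have hs2 : Real.sqrt 2 < 14142135624 / 10 ^ 10 := sqrt_two_lt_14142135624
  have hA := two_mul_sub_mul_re_expect_le_secant (t' := (0 : ℝ)) (U := (8 : ℝ)) (h₁ := Real.sqrt 2 * (4 / 25 : ℝ)) hω₁ hρ₁ hmin₂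
  have hB := secant_le_two_mul_sub_mul_re_expect (t' := (0 : ℝ)) (U := (8 : ℝ)) (h₂ := Real.sqrt 2 * (1 / 4 : ℝ)) hω₂ hρ₂ hmin₁
  have hfloor := canonicalFloor_n7o8_tp0_W64W32twoW5k3o7r529_decimal_g4o25 hω₁ hρ₁ hmin₁ hfl hW₁ hW₂
  have hlid := canonicalCeiling_n7o8_tp0_W32twoW5k4o7_b0_decimal_g1o4_r5o7 hω₂ hρ₂ hmin₂ hV₁ hV₂ hN
  have hd : 0 < Real.sqrt 2 * (1 / 4 : ℝ) - Real.sqrt 2 * (4 / 25 : ℝ) := by nlinarith [hs1]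
  constructor
  · nlinarith [mul_le_mul_of_nonneg_left hfloor hd.le, hs1]
  · nlinarith [mul_le_mul_of_nonneg_left hlid hd.le, hs2]

/-- **SECOND-DIFFERENCE (concavity) INSTANCE at the certified fields `√2·4/25 < √2·1/4 < √2·2/7`** (A0′; certificate-free specialisation of p676488's
`secant_secondDifference_nonpos`): `(h₃ − h₂)·(E_{h₁}(ω₁) − E_{h₂}(ω₂)) ≤ (h₂ − h₁)·(E_{h₂}(ω₂) − E_{h₃}(ω₃))` for translation-invariant density-⅞ minimisers
`ω₁, ω₂, ω₃` at the three fields. No node premise. [cite: Griffiths1966, §II] -/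
theorem secondDifference_n7o8_tp0_g4o25_g1o4_g2o7
    (hω₂ : ω₂.IsTranslationInvariant) (hρ₂ : ω₂.density = 7 / 8)
    (hmin₁ : ∀ ω' : InfVolFermionState 2, ω'.IsTranslationInvariant → ω'.density = 7 / 8 →
      ω₁.meanEnergy (hubbardTTPrimeSourcedInteraction 1 0 8 0 dWaveFormFactor (Real.sqrt 2 * (4 / 25 : ℝ))) 1 ≤
        ω'.meanEnergy (hubbardTTPrimeSourcedInteraction 1 0 8 0 dWaveFormFactor (Real.sqrt 2 * (4 / 25 : ℝ))) 1)
    (hmin₃ : ∀ ω' : InfVolFermionState 2, ω'.IsTranslationInvariant → ω'.density = 7 / 8 →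
      ω₃.meanEnergy (hubbardTTPrimeSourcedInteraction 1 0 8 0 dWaveFormFactor (Real.sqrt 2 * (2 / 7 : ℝ))) 1 ≤
        ω'.meanEnergy (hubbardTTPrimeSourcedInteraction 1 0 8 0 dWaveFormFactor (Real.sqrt 2 * (2 / 7 : ℝ))) 1) :
    (Real.sqrt 2 * (2 / 7 : ℝ) - Real.sqrt 2 * (1 / 4 : ℝ)) *
        (ω₁.meanEnergy (hubbardTTPrimeSourcedInteraction 1 0 8 0 dWaveFormFactor (Real.sqrt 2 * (4 / 25 : ℝ))) 1 -
          ω₂.meanEnergy (hubbardTTPrimeSourcedInteraction 1 0 8 0 dWaveFormFactor (Real.sqrt 2 * (1 / 4 : ℝ))) 1) ≤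
      (Real.sqrt 2 * (1 / 4 : ℝ) - Real.sqrt 2 * (4 / 25 : ℝ)) *
        (ω₂.meanEnergy (hubbardTTPrimeSourcedInteraction 1 0 8 0 dWaveFormFactor (Real.sqrt 2 * (1 / 4 : ℝ))) 1 -
          ω₃.meanEnergy (hubbardTTPrimeSourcedInteraction 1 0 8 0 dWaveFormFactor (Real.sqrt 2 * (2 / 7 : ℝ))) 1) := by
  have hs : 0 < Real.sqrt 2 := Real.sqrt_pos.2 (by norm_num)
  exact secant_secondDifference_nonpos (t' := (0 : ℝ)) (U := (8 : ℝ)) (by nlinarith [hs]) (by nlinarith [hs]) hω₂ hρ₂ hmin₁ hmin₃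

/-! ## §2. v21-LID EDITION of the energy-drop bracket (hubbard-floor eng-1 g5; pre-stated upper word 0.2360964) -/

/-- **CERTIFIED ENERGY-DROP BRACKET between `h₁ = √2·4/25` and `h₂ = √2·1/4`, v21-LID EDITION (A0′, #529 floor / W64 ⊕ W32 κ 3/7 near-row lid).** For
translation-invariant density-⅞ minimisers `ω₁` of `E_{h₁}` and `ω₂` of `E_{h₂}`: `0.0037571 ≤ E_{h₁}(ω₁) − E_{h₂}(ω₂) ≤ 0.2360964` (energies per site). Lower end =
Griffiths secant `2(h₂−h₁)·m(ω₁) ≤ ΔE` (p676488) + floor `0.0147595 ≤ m(ω₁)` (cq p539006 `canonicalFloor_n7o8_tp0_W64W32twoW5k3o7r529_decimal_g4o25`); upper end =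
`ΔE ≤ 2(h₂−h₁)·m(ω₂)` + the v21 minimal lid `m(ω₂) ≤ 0.9274741` (eng-1 p710806 `canonicalCeiling_n7o8_tp0_W64W32twoW5k3o7_b1_decimal_g1o4_r5o7`); `√2 ∈ (1.4142135623, 1.4142135624)`;
exact upper end `2√2·(9/100)·0.9274741 = 0.23609636…` ⇒ 7 dp UP `0.2360964` (the theorem `energyDrop_n7o8_tp0_r529_g4o25_g1o4_bounds` above is the v17-lid edition: its STATEMENT uses
`0.9285738`, cq p708763, upper word `0.2363763` — its docstring's mention of `0.9274741` / p710806 is a slip; this decl is that edition). CONDITIONAL by name on FOUR nodes only —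
#529, the κ 3/7 boxes R5′ `j276038` ⊕ R6 `j269676` (shared by floor AND lid), the pin-1 menu row 5/7 `j287398`; an arithmetic corollary of numbers of record (kinematic width
0.2323393), no shape information; never an onset / order parameter / gap / `T_c`. [cite: Griffiths1966, §II] -/
theorem energyDrop_n7o8_tp0_r529_g4o25_g1o4_bounds_W64W32lid
    (hω₁ : ω₁.IsTranslationInvariant) (hρ₁ : ω₁.density = 7 / 8)
    (hmin₁ : ∀ ω' : InfVolFermionState 2, ω'.IsTranslationInvariant → ω'.density = 7 / 8 →
      ω₁.meanEnergy (hubbardTTPrimeSourcedInteraction 1 0 8 0 dWaveFormFactor (Real.sqrt 2 * (4 / 25 : ℝ))) 1 ≤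
        ω'.meanEnergy (hubbardTTPrimeSourcedInteraction 1 0 8 0 dWaveFormFactor (Real.sqrt 2 * (4 / 25 : ℝ))) 1)
    (hω₂ : ω₂.IsTranslationInvariant) (hρ₂ : ω₂.density = 7 / 8)
    (hmin₂ : ∀ ω' : InfVolFermionState 2, ω'.IsTranslationInvariant → ω'.density = 7 / 8 →
      ω₂.meanEnergy (hubbardTTPrimeSourcedInteraction 1 0 8 0 dWaveFormFactor (Real.sqrt 2 * (1 / 4 : ℝ))) 1 ≤
        ω'.meanEnergy (hubbardTTPrimeSourcedInteraction 1 0 8 0 dWaveFormFactor (Real.sqrt 2 * (1 / 4 : ℝ))) 1)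
    (hfl : cert_r529_HYB_GU8n7o8eom8_w3_b4_R2_ob5p2_kry1_kry2c3rel_menu_core_focert_it2000)
    (hW₁ : cert_sgf_openbox64x4_U8_mu980464777135o549755813888_k3o7_j276038_twoField) (hW₂ : cert_sgf_openbox32x4_U8_mu2_k3o7_j269676_twoField)
    (hN : cert_pin1menuA0p_L3h0_U8_tp0_g5o7_E_j287398) :
    (0.0037571 : ℝ) ≤ ω₁.meanEnergy (hubbardTTPrimeSourcedInteraction 1 0 8 0 dWaveFormFactor (Real.sqrt 2 * (4 / 25 : ℝ))) 1 -
        ω₂.meanEnergy (hubbardTTPrimeSourcedInteraction 1 0 8 0 dWaveFormFactor (Real.sqrt 2 * (1 / 4 : ℝ))) 1 ∧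
      ω₁.meanEnergy (hubbardTTPrimeSourcedInteraction 1 0 8 0 dWaveFormFactor (Real.sqrt 2 * (4 / 25 : ℝ))) 1 -
        ω₂.meanEnergy (hubbardTTPrimeSourcedInteraction 1 0 8 0 dWaveFormFactor (Real.sqrt 2 * (1 / 4 : ℝ))) 1 ≤ (0.2360964 : ℝ) := by
  have hs1 : (14142135623 / 10 ^ 10 : ℝ) < Real.sqrt 2 := by rw [Real.lt_sqrt (by norm_num)]; norm_num
  have hs2 : Real.sqrt 2 < 14142135624 / 10 ^ 10 := sqrt_two_lt_14142135624
  have hA := two_mul_sub_mul_re_expect_le_secant (t' := (0 : ℝ)) (U := (8 : ℝ)) (h₁ := Real.sqrt 2 * (4 / 25 : ℝ)) hω₁ hρ₁ hmin₂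
  have hB := secant_le_two_mul_sub_mul_re_expect (t' := (0 : ℝ)) (U := (8 : ℝ)) (h₂ := Real.sqrt 2 * (1 / 4 : ℝ)) hω₂ hρ₂ hmin₁
  have hfloor := canonicalFloor_n7o8_tp0_W64W32twoW5k3o7r529_decimal_g4o25 hω₁ hρ₁ hmin₁ hfl hW₁ hW₂
  have hlid := canonicalCeiling_n7o8_tp0_W64W32twoW5k3o7_b1_decimal_g1o4_r5o7 hω₂ hρ₂ hmin₂ hW₁ hW₂ hN
  have hd : 0 < Real.sqrt 2 * (1 / 4 : ℝ) - Real.sqrt 2 * (4 / 25 : ℝ) := by nlinarith [hs1]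
  constructor
  · nlinarith [mul_le_mul_of_nonneg_left hfloor hd.le, hs1]
  · nlinarith [mul_le_mul_of_nonneg_left hlid hd.le, hs2]

end Summit.Ventures.CertifiedManyBodySolver.Observables

end
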